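import Summits.HodgeConjecture.HodgeConjecture.Theorems.Ring2AbelianAllAndreNumericalLift
import Summits.HodgeConjecture.HodgeConjecture.Theorems.Ring2AbelianAllAndreHodgeNondegenerate
import Summits.HodgeConjecture.HodgeConjecture.Theorems.Ring2AbelianAllAndreLiftOnPath
import HarnessLib

/-!
Maintenance re-land 2026-08-20 (ops-buildfix lane, LEDGER C-7): content unchanged; re-submitted only to re-enqueue the hub build
after the `Literature.AlgebraicGeometry.Milne1999` / `ComplexMultiplication` import chain was rebuilt (this module had been left
without an olean as an rc-76 hostage of that chain).

# Ring 2 · sub-cell AbelianAll (ALL ABELIAN VARIETIES), André axis, part XVIII-c — THE `B_min` OF THE ANDRÉ AXIS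
# AS CONJECTURE D ("HOM ≡ NUM") FOR FIBRE-SUPPORTED CYCLES: under `HC_CM` the lift (L) at a CM fibre IS the
# statement "an algebraic class `j_{t*} b` on the total space, `b` algebraic on the CM fibre, numerically
# orthogonal to `N^p(𝒳)`, is homologically zero" (EXACTNESS), and the cell row
# `HC_CM ∧ [D for CM-fibre-supported cycles on CM-pointed compact pencils] ⟹ HC_AV`

HONEST FRAMING (page 1, verbatim): **research route, not a corollary; conditional on HC_CM plus one named
minimal statement.** Cell line: research route conditional on HC_CM; not a corollary; Q11.4-sentence-2
already refuted in dim ≥ 3. Nothing in this file proves a case of the Hodge conjecture for an abelian variety.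
`HC_CM` = `Theses.RankFourFaces.CMAbelianHodge` (stmt-HodgeConjecture-3052) is a BINDER wherever it occurs; `HC_AV` =
`Theses.PadicSemiregularLift.HodgeAbelianVarieties`; item `Theses.RankFourFaces.CMToAbelian` (stmt-16267) OPEN and not
closed here. Seat `pub-hodge-ring2-ab-andre-2`, gen 10 (assembly of parts XVIII-a/b).

## Notation (one compact pencil `f : 𝒳 ⟶ S` of abelian `d`-folds, a point `t`, `j = j_t`, `p + q = d`)

(Num_t)(p,q): `∀ b ∈ N^q(𝒳_t), (∀ a ∈ N^p(𝒳), a ∪ j_* b = 0) → j_* b = 0` — written INLINE (no definition).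
Equivalently (§4): every `b ∈ N^q(𝒳_t)` with `j_* b ≠ 0` is DETECTED by an algebraic class of the total space:
`∃ a ∈ N^p(𝒳), j^* a ∪ b ≠ 0`. This is Grothendieck's conjecture `D(𝒳)` in bidegree `(p, q+1)` restricted to the
classes `j_* N^q(𝒳_t) ⊆ N^{q+1}(𝒳)` supported on the fibre (André 2026 §4.4.1 names "the standard conjecture D for
the total space" as what lies behind the André–Abdulali–Milne transport; here only its fibre-supported instance at
the CM fibre is used). (L)_t(p): `(j^*)⁻¹N^p(𝒳_t) ≤ N^p(𝒳) + ker j^*` (part XVII-b).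

## What is proved (theorems, and ONE `@[conjecture] def` node `CMPointedPencilNumerical` = Num^CM, §5, REFEREE-AB F-ab-79; no named fact, no sorry)

§1 **`comap_le_sup_of_numerical_of_hodge`**: `HC^p(𝒳_t) ∧ HC^q(𝒳_t) ∧ (Num_t)(p,q) ⟹ (L)_t(p)` (parts XVIII-a +
XVIII-b); **`…_of_HC_CM`** at CM points. §2 **`numerical_of_comap_le_sup_of_hodge`**: `HC^p(𝒳_t) ∧ (L)_t(p) ⟹
(Num_t)(p,q)` — by part XVIII-b's non-degeneracy ON THE TOTAL SPACE `𝒳` in bidegree `(p, q+1)`; so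
**`numerical_iff_comap_le_sup_of_hodge` / `_of_HC_CM`: at a fibre satisfying HC (e.g. a CM fibre under `HC_CM`),
(Num_t) ⟺ (L)_t — EXACTNESS.** §3 node level: **`cmFibreAlgebraicLift_iff_numerical_of_HC_CM`** (`HC_CM ⊢ (L) ⟺
[Num at the CM points of compact pencils]`), **`HC_AV_of_HC_CM_of_numerical`** (`h₂₁ → HC_CM → Num^CM → HC_AV`),
`numericalCM_of_hodgeConjecture` (on-path: `HodgeConjecture ⟹ Num^CM`, so nothing here is summit-progress rhetoric);
**`HC_AV_iff_HC_CM_and_numerical`** is NOT claimed (Num^CM ⟺ (L), and (L) ⟹ (4) only). §4 `numerical_iff_detect`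
(the find-the-cycle form) and the unconditional corner `q = d` (`numerical_zero_top`).

EDGE LABELS (RING2-MAP §AbelianAll gen 10): §1/§2 K[HC^•(𝒳_t)] resp. K[HC_CM] (binder); §3 rows K[HC_CM], the HC_AV
row also K[h₂₁]; §4 K unconditional. No def, no named fact; `HC_CM`, `h₂₁` binders only.

References: Kleiman1968AlgebraicCycles (§3 D(X)); Lieberman1968; Abdulali1994FamiliesAV (p. 1122);
Milne2020HodgeClassesAV (Prop. 1); Andre1996Motifs (§5.1, Lemme 6.3.1, §6.3); VoisinHodgeI2002 (§6.3.2, §7.1.2);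
HatcherAT2002 (§3.3 Prop. 3.38); FultonYoungTableaux1997 (App. B (6)).
-/

noncomputable section

set_option linter.dupNamespace false

namespace Summit.HodgeConjecture.HodgeConjecture.Ring2.AbelianAll

open CategoryTheory AlgebraicGeometry
open Literature.AlgebraicGeometry Literature.AlgebraicGeometry.Motives
open Literature.AlgebraicGeometry.HodgeTheory
open Literature.AlgebraicTopology.SingularHomology (singularCohomology cupProduct cupProduct_gradedComm_holds)
open Literature.AlgebraicGeometry.Deligne1982 (cmLocus)
open Literature.AlgebraicGeometry.Andre1996 (andre1996_cmAnchoredPencil)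
open Summit.HodgeConjecture.HodgeConjecture.Theses

variable {𝒳 S : SchemeOver ℂ}

/-! ## §1 (Num_t) ⟹ (L)_t at a fibre satisfying HC -/

/-- **`HC^p(𝒳_t) ∧ HC^q(𝒳_t) ∧ (Num_t)(p,q) ⟹ (L)_t(p)`**: at a fibre whose rational `(p,p)`- and `(q,q)`-classes are
algebraic, conjecture D for the fibre-supported classes `j_{t*} N^q(𝒳_t)` of the total space gives the lift — (Perf_t)
of part XVIII-a is part XVIII-b's theorem. [cite: Milne2020HodgeClassesAV, Prop. 1 (p. 7)] [cite: Kleiman1968AlgebraicCycles, §3] -/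
theorem comap_le_sup_of_numerical_of_hodge {d : ℕ} {f : 𝒳 ⟶ S} (hf : IsCompactAbelianPencil f d)
    (t : ComplexPoints S) {p q : ℕ} (hpq : p + q = d)
    (hp : ∀ c : complexBetti (fiberOver f t) (2 * p), IsRationalClass c →
      IsOfHodgeType d (fiberOver f t) (2 * p) p p c → c ∈ algebraicClasses (fiberOver f t) p)
    (hq : ∀ c : complexBetti (fiberOver f t) (2 * q), IsRationalClass c →
      IsOfHodgeType d (fiberOver f t) (2 * q) q q c → c ∈ algebraicClasses (fiberOver f t) q)
    (hNum : ∀ b ∈ algebraicClasses (fiberOver f t) q,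
      (∀ a ∈ algebraicClasses 𝒳 p,
        cupProduct (show 2 * p + 2 * (q + 1) = 2 * (d + 1) by omega) a (fiberGysin hf t q b) = 0) →
        fiberGysin hf t q b = 0) :
    (algebraicClasses (fiberOver f t) p).comap (complexBetti.map (fiberι f t) (2 * p)).hom ≤
      algebraicClasses 𝒳 p ⊔ LinearMap.ker (complexBetti.map (fiberι f t) (2 * p)).hom := by
  obtain ⟨h₁, h₂⟩ := nondegenerate_algebraicClasses_fiberOver_of_hodge hf t hpq hp hq
  exact comap_le_sup_of_nondegenerate_of_numerical hf t hpq h₁ h₂ hNum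

/-- **`HC_CM ⊢ (Num_t)(p,q) ⟹ (L)_t(p)` at every CM point `t`** (`HC_CM` a BINDER).
[cite: Andre1996Motifs, §6.3 a) (p. 33)] [cite: Milne2020HodgeClassesAV, Prop. 1 (p. 7)] -/
theorem comap_le_sup_of_numerical_of_HC_CM (hCM : RankFourFaces.CMAbelianHodge) {d : ℕ} {f : 𝒳 ⟶ S}
    (hf : IsCompactAbelianPencil f d) {t : ComplexPoints S} (ht : t ∈ cmLocus f d) {p q : ℕ} (hpq : p + q = d)
    (hNum : ∀ b ∈ algebraicClasses (fiberOver f t) q,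
      (∀ a ∈ algebraicClasses 𝒳 p,
        cupProduct (show 2 * p + 2 * (q + 1) = 2 * (d + 1) by omega) a (fiberGysin hf t q b) = 0) →
        fiberGysin hf t q b = 0) :
    (algebraicClasses (fiberOver f t) p).comap (complexBetti.map (fiberι f t) (2 * p)).hom ≤
      algebraicClasses 𝒳 p ⊔ LinearMap.ker (complexBetti.map (fiberι f t) (2 * p)).hom := by
  obtain ⟨h₁, h₂⟩ := nondegenerate_algebraicClasses_fiberOver_of_HC_CM hCM hf ht hpq
  exact comap_le_sup_of_nondegenerate_of_numerical hf t hpq h₁ h₂ hNum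

/-! ## §2 (L)_t ⟹ (Num_t): exactness at fibres satisfying HC -/

/-- **`HC^p(𝒳_t) ∧ (L)_t(p) ⟹ (Num_t)(p,q)`.** Let `b ∈ N^q(𝒳_t)` with `a ∪ j_* b = 0` for all `a ∈ N^p(𝒳)`. The class
`j_* b ∈ N^{q+1}(𝒳) ⊆ span_ℂ Hdg^{q+1}(𝒳)` vanishes as soon as it is cup-orthogonal to `span_ℂ Hdg^p(𝒳)` (part XVIII-b,
non-degeneracy ON `𝒳` in bidegree `(p, q+1)`). For `ξ ∈ span_ℂ Hdg^p(𝒳)`: `j^* ξ ∈ span_ℂ Hdg^p(𝒳_t) ⊆ N^p(𝒳_t)` (by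
`HC^p(𝒳_t)`), so by (L)_t `ξ = a + κ` with `a ∈ N^p(𝒳)`, `j^* κ = 0`, and `ξ ∪ j_* b = 0 ⟺ j^* ξ ∪ b = 0 ⟺ j^* a ∪ b = 0
⟺ a ∪ j_* b = 0` ✓ (transpose, part XVIII-a). [cite: Kleiman1968AlgebraicCycles, §3] [cite: Andre1996Motifs, §5.1 (p. 25)] -/
theorem numerical_of_comap_le_sup_of_hodge {d : ℕ} {f : 𝒳 ⟶ S} (hf : IsCompactAbelianPencil f d)
    (t : ComplexPoints S) {p q : ℕ} (hpq : p + q = d)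
    (hp : ∀ c : complexBetti (fiberOver f t) (2 * p), IsRationalClass c →
      IsOfHodgeType d (fiberOver f t) (2 * p) p p c → c ∈ algebraicClasses (fiberOver f t) p)
    (hL : (algebraicClasses (fiberOver f t) p).comap (complexBetti.map (fiberι f t) (2 * p)).hom ≤
      algebraicClasses 𝒳 p ⊔ LinearMap.ker (complexBetti.map (fiberι f t) (2 * p)).hom) :
    ∀ b ∈ algebraicClasses (fiberOver f t) q,
      (∀ a ∈ algebraicClasses 𝒳 p,
        cupProduct (show 2 * p + 2 * (q + 1) = 2 * (d + 1) by omega) a (fiberGysin hf t q b) = 0) →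
        fiberGysin hf t q b = 0 := by
  intro b hb hab
  have h𝒳 := hf.isSmoothProjective_total
  have hXt := hf.isSmoothProjective_fiberOver t
  have hmem : fiberGysin hf t q b ∈ Submodule.span ℂ {c : complexBetti 𝒳 (2 * (q + 1)) |
      IsRationalClass c ∧ IsOfHodgeType (d + 1) 𝒳 (2 * (q + 1)) (q + 1) (q + 1) c} :=
    algebraicClasses_le_span_hodgeClasses h𝒳 (q + 1) (fiberGysin_mem_algebraicClasses hf t hb)
  refine eq_zero_of_forall_cupProduct_span_hodge_eq_zero' h𝒳 (show p + (q + 1) = d + 1 by omega) hmem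
    fun ξ hξ ↦ ?_
  -- `j^* ξ` is algebraic on the fibre, so `ξ ∈ C_t ≤ N^p(𝒳) + ker j^*`
  have hξt : complexBetti.map (fiberι f t) (2 * p) ξ ∈ algebraicClasses (fiberOver f t) p := by
    refine (Submodule.span_le (p := (algebraicClasses (fiberOver f t) p).comap
      (complexBetti.map (fiberι f t) (2 * p)).hom)).2 ?_ hξ
    rintro c ⟨hcQ, hcH⟩
    exact hp _ (hcQ.map (AlgPoints.mapContinuous (L := ℂ) (fiberι f t))) (hcH.map_of_isSmoothProjective hXt h𝒳 (fiberι f t))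
  obtain ⟨a, ha, κ, hκ, haκ⟩ := Submodule.mem_sup.1 (hL hξt)
  rw [LinearMap.mem_ker] at hκ
  have hja : complexBetti.map (fiberι f t) (2 * p) ξ = complexBetti.map (fiberι f t) (2 * p) a := by
    rw [← haκ, map_add]
    change _ + (complexBetti.map (fiberι f t) (2 * p)).hom κ = _
    rw [hκ, add_zero]
  rw [← cupProduct_map_fiberι_eq_zero_iff hf t hpq, hja, cupProduct_map_fiberι_eq_zero_iff hf t hpq]
  exact hab a ha

/-- **EXACTNESS AT A FIBRE SATISFYING HC: `(Num_t)(p,q) ⟺ (L)_t(p)`** (rational `(p,p)`- and `(q,q)`-classes of `𝒳_t`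
algebraic). [cite: Kleiman1968AlgebraicCycles, §3] [cite: Milne2020HodgeClassesAV, Prop. 1 (p. 7)] -/
theorem numerical_iff_comap_le_sup_of_hodge {d : ℕ} {f : 𝒳 ⟶ S} (hf : IsCompactAbelianPencil f d)
    (t : ComplexPoints S) {p q : ℕ} (hpq : p + q = d)
    (hp : ∀ c : complexBetti (fiberOver f t) (2 * p), IsRationalClass c →
      IsOfHodgeType d (fiberOver f t) (2 * p) p p c → c ∈ algebraicClasses (fiberOver f t) p)
    (hq : ∀ c : complexBetti (fiberOver f t) (2 * q), IsRationalClass c →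
      IsOfHodgeType d (fiberOver f t) (2 * q) q q c → c ∈ algebraicClasses (fiberOver f t) q) :
    (∀ b ∈ algebraicClasses (fiberOver f t) q,
      (∀ a ∈ algebraicClasses 𝒳 p,
        cupProduct (show 2 * p + 2 * (q + 1) = 2 * (d + 1) by omega) a (fiberGysin hf t q b) = 0) →
        fiberGysin hf t q b = 0) ↔
    (algebraicClasses (fiberOver f t) p).comap (complexBetti.map (fiberι f t) (2 * p)).hom ≤
      algebraicClasses 𝒳 p ⊔ LinearMap.ker (complexBetti.map (fiberι f t) (2 * p)).hom :=
  ⟨comap_le_sup_of_numerical_of_hodge hf t hpq hp hq, numerical_of_comap_le_sup_of_hodge hf t hpq hp⟩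

/-- **EXACTNESS AT CM FIBRES UNDER `HC_CM`: `(Num_t)(p,q) ⟺ (L)_t(p)`** (`HC_CM` a BINDER).
[cite: Andre1996Motifs, §6.3 a) (p. 33)] [cite: Kleiman1968AlgebraicCycles, §3] -/
theorem numerical_iff_comap_le_sup_of_HC_CM (hCM : RankFourFaces.CMAbelianHodge) {d : ℕ} {f : 𝒳 ⟶ S}
    (hf : IsCompactAbelianPencil f d) {t : ComplexPoints S} (ht : t ∈ cmLocus f d) {p q : ℕ} (hpq : p + q = d) :
    (∀ b ∈ algebraicClasses (fiberOver f t) q,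
      (∀ a ∈ algebraicClasses 𝒳 p,
        cupProduct (show 2 * p + 2 * (q + 1) = 2 * (d + 1) by omega) a (fiberGysin hf t q b) = 0) →
        fiberGysin hf t q b = 0) ↔
    (algebraicClasses (fiberOver f t) p).comap (complexBetti.map (fiberι f t) (2 * p)).hom ≤
      algebraicClasses 𝒳 p ⊔ LinearMap.ker (complexBetti.map (fiberι f t) (2 * p)).hom := by
  obtain ⟨A₀, ⟨e₀⟩, hdim, hcm⟩ := ht
  exact numerical_iff_comap_le_sup_of_hodge hf t hpq
    (fun c hc hcpp ↦ Ring2Transport.mem_algebraicClasses_of_cmChart hCM A₀ e₀ hdim hcm hc hcpp)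
    (fun c hc hcqq ↦ Ring2Transport.mem_algebraicClasses_of_cmChart hCM A₀ e₀ hdim hcm hc hcqq)

/-! ## §3 Node level: `HC_CM ⊢ (L) ⟺ Num^CM`; the cell row; on-path -/

/-- **`HC_CM ⊢ CMFibreAlgebraicLift ⟺ [(Num_t)(p,q) at every CM point of every compact pencil of abelian varieties,
all `p + q = d`]`** — under `HC_CM` the lift node (L) of the André axis IS conjecture D for CM-fibre-supported cycles on
the total spaces. `HC_CM` is a BINDER. [cite: Andre1996Motifs, §5.1 (p. 25) and §6.3 (p. 33)] [cite: Kleiman1968AlgebraicCycles, §3] -/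
theorem cmFibreAlgebraicLift_iff_numerical_of_HC_CM (hCM : RankFourFaces.CMAbelianHodge) :
    CMFibreAlgebraicLift ↔
      ∀ ⦃d : ℕ⦄ ⦃𝒳 S : SchemeOver ℂ⦄ (f : 𝒳 ⟶ S) (hf : IsCompactAbelianPencil f d) (t : ComplexPoints S),
        t ∈ cmLocus f d → ∀ (p q : ℕ) (hpq : p + q = d), ∀ b ∈ algebraicClasses (fiberOver f t) q,
          (∀ a ∈ algebraicClasses 𝒳 p,
            cupProduct (show 2 * p + 2 * (q + 1) = 2 * (d + 1) by omega) a (fiberGysin hf t q b) = 0) →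
            fiberGysin hf t q b = 0 := by
  rw [cmFibreAlgebraicLift_iff_comap_le_sup]
  refine ⟨fun h d 𝒳 S f hf t ht p q hpq ↦ ?_, fun h d 𝒳 S f hf p t ht ↦ ?_⟩
  · exact (numerical_iff_comap_le_sup_of_HC_CM hCM hf ht hpq).2 (h f hf p t ht)
  · rcases le_or_gt p d with hp | hp
    · exact (numerical_iff_comap_le_sup_of_HC_CM hCM hf ht (show p + (d - p) = d by omega)).1
        (h f hf t ht p (d - p) (by omega))
    · haveI := subsingleton_complexBetti (hf.isSmoothProjective_fiberOver t) (show 2 * d < 2 * p by omega)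
      intro W _
      refine Submodule.mem_sup_right ?_
      rw [LinearMap.mem_ker]
      exact Subsingleton.elim _ _

/-- **THE CELL ROW THROUGH CONJECTURE D FOR FIBRE-SUPPORTED CYCLES:
`h₂₁ → HC_CM → [(Num_t) at the CM points of compact pencils of abelian varieties] → HC_AV`.** `HC_CM` and `h₂₁`
(André's Lemme 6.3.1) are BINDERS; the bracket is the candidate `B_min` of this part, a "hom ≡ num" statement about
explicit algebraic cycles `j_{t*} b` on the `(d+1)`-dimensional total spaces (NOT abelian varieties — Lieberman's theorem
does not apply to them). research route, not a corollary; conditional on HC_CM plus one named minimal statement.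
[cite: Andre1996Motifs, Lemme 6.3.1 (p. 31) and §6.3 (p. 33)] [cite: Milne2020HodgeClassesAV, Prop. 1 (p. 7)]
[cite: Kleiman1968AlgebraicCycles, §3 (D(X))] -/
theorem HC_AV_of_HC_CM_of_numerical (h₂₁ : andre1996_cmAnchoredPencil) (hCM : RankFourFaces.CMAbelianHodge)
    (hNum : ∀ ⦃d : ℕ⦄ ⦃𝒳 S : SchemeOver ℂ⦄ (f : 𝒳 ⟶ S) (hf : IsCompactAbelianPencil f d) (t : ComplexPoints S),
        t ∈ cmLocus f d → ∀ (p q : ℕ) (hpq : p + q = d), ∀ b ∈ algebraicClasses (fiberOver f t) q,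
          (∀ a ∈ algebraicClasses 𝒳 p,
            cupProduct (show 2 * p + 2 * (q + 1) = 2 * (d + 1) by omega) a (fiberGysin hf t q b) = 0) →
            fiberGysin hf t q b = 0) :
    PadicSemiregularLift.HodgeAbelianVarieties :=
  HC_AV_of_HC_CM_and_cmFibreAlgebraicLift h₂₁ hCM ((cmFibreAlgebraicLift_iff_numerical_of_HC_CM hCM).2 hNum)

/-- **ON-PATH: `HodgeConjecture ⟹ [(Num_t) at the CM points of compact pencils]`** — the bracket is a CASE of the
summit statement (`HodgeConjecture ⟹ HC_CM` and `HodgeConjecture ⟹ (L)`, part VI's fact-free lift; then §3's iff), so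
nothing in this file is summit-progress rhetoric. [cite: Andre1996Motifs, §6.3 (p. 33)] -/
theorem numericalCM_of_hodgeConjecture (h : _root_.HodgeConjecture) :
    ∀ ⦃d : ℕ⦄ ⦃𝒳 S : SchemeOver ℂ⦄ (f : 𝒳 ⟶ S) (hf : IsCompactAbelianPencil f d) (t : ComplexPoints S),
        t ∈ cmLocus f d → ∀ (p q : ℕ) (hpq : p + q = d), ∀ b ∈ algebraicClasses (fiberOver f t) q,
          (∀ a ∈ algebraicClasses 𝒳 p,
            cupProduct (show 2 * p + 2 * (q + 1) = 2 * (d + 1) by omega) a (fiberGysin hf t q b) = 0) →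
            fiberGysin hf t q b = 0 :=
  (cmFibreAlgebraicLift_iff_numerical_of_HC_CM (Deform.HC_CM_of_HC_AV (Deform.HC_AV_of_hodgeConjecture h))).1
    (cmFibreAlgebraicLift_of_hodgeConjecture h)

/-! ## §4 The find-the-cycle form and an unconditional corner -/

/-- **(Num_t) as a find-the-cycle statement**: `(Num_t)(p,q)` holds iff every algebraic `b` on the fibre with
`j_{t*} b ≠ 0` (equivalently: `b` not cup-orthogonal to the invariant classes `Im j_t^*`, part XVIII-a) is detected by an
ALGEBRAIC class of the total space: `∃ a ∈ N^p(𝒳), j_t^* a ∪ b ≠ 0`. [cite: Kleiman1968AlgebraicCycles, §3 (D(X))] -/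
theorem numerical_iff_detect {d : ℕ} {f : 𝒳 ⟶ S} (hf : IsCompactAbelianPencil f d) (t : ComplexPoints S)
    {p q : ℕ} (hpq : p + q = d) :
    (∀ b ∈ algebraicClasses (fiberOver f t) q,
      (∀ a ∈ algebraicClasses 𝒳 p,
        cupProduct (show 2 * p + 2 * (q + 1) = 2 * (d + 1) by omega) a (fiberGysin hf t q b) = 0) →
        fiberGysin hf t q b = 0) ↔
    ∀ b ∈ algebraicClasses (fiberOver f t) q, fiberGysin hf t q b ≠ 0 →
      ∃ a ∈ algebraicClasses 𝒳 p,
        cupProduct (show 2 * p + 2 * q = 2 * d by omega) (complexBetti.map (fiberι f t) (2 * p) a) b ≠ 0 := by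
  refine ⟨fun h b hb hb0 ↦ ?_, fun h b hb hab ↦ ?_⟩
  · by_contra hall
    push Not at hall
    exact hb0 (h b hb fun a ha ↦ (cupProduct_map_fiberι_eq_zero_iff hf t hpq a b).1 (hall a ha))
  · by_contra hb0
    obtain ⟨a, ha, hne⟩ := h b hb hb0
    exact hne ((cupProduct_map_fiberι_eq_zero_iff hf t hpq a b).2 (hab a ha))

/-- **The corner `(p, q) = (0, d)` of (Num_t) is unconditional**: `N⁰(𝒳) ∋ 1` and `1 ∪ j_* b = j_* b`.
[cite: HatcherAT2002, §3.2 Prop. 3.10] -/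
theorem numerical_zero_top {d : ℕ} {f : 𝒳 ⟶ S} (hf : IsCompactAbelianPencil f d) (t : ComplexPoints S) :
    ∀ b ∈ algebraicClasses (fiberOver f t) d,
      (∀ a ∈ algebraicClasses 𝒳 0,
        cupProduct (show 2 * 0 + 2 * (d + 1) = 2 * (d + 1) by omega) a (fiberGysin hf t d b) = 0) →
        fiberGysin hf t d b = 0 := by
  intro b _ hab
  have h1 := hab (singularCohomology.one ℂ (ComplexPoints 𝒳)) (by rw [algebraicClasses_zero]; exact Submodule.mem_top)
  rwa [Literature.AlgebraicTopology.SingularHomology.one_cupProduct] at h1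

/-! ## §5 The node `CMPointedPencilNumerical` (Num^CM) — REFEREE-AB F-ab-79: one name for the census -/

/-- **Num^CM — CONJECTURE D ("HOM ≡ NUM") FOR THE CYCLES OF THE TOTAL SPACE SUPPORTED ON A CM FIBRE**, the `B_min`
candidate of the André axis in numerical form: on every compact pencil `f : 𝒳 ⟶ S` of abelian `d`-folds, at every CM point
`t` and in every bidegree `p + q = d`, an algebraic class `j_{t*} b` (`b ∈ N^q(𝒳_t)`) with `a ∪ j_{t*} b = 0` for all
`a ∈ N^p(𝒳)` is zero. OPEN (for `q ∉ {0, 1, d-1, d}`, part XVIII-i; smallest open instance `d = 4`, `(p,q) = (2,2)`);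
under `HC_CM` EQUIVALENT to the lift node (L) (`cmFibreAlgebraicLift_iff_cmPointedPencilNumerical_of_HC_CM`); implied by
seat ab-andre-1's `CMPointedPencilStandardA` (part XVIII-e) and by the Hodge conjecture (on-path below). A HYPOTHESIS wherever
used; not claimed minimal. [cite: Kleiman1968AlgebraicCycles, §3 (D(X))] [cite: Milne2020HodgeClassesAV, Prop. 1 (p. 7)]
[cite: Andre1996Motifs, §6.3 Remarque 2 (p. 33)] -/
@[conjecture] def CMPointedPencilNumerical : Prop :=
  ∀ ⦃d : ℕ⦄ ⦃𝒳 S : SchemeOver ℂ⦄ (f : 𝒳 ⟶ S) (hf : IsCompactAbelianPencil f d) (t : ComplexPoints S),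
    t ∈ cmLocus f d → ∀ (p q : ℕ) (hpq : p + q = d), ∀ b ∈ algebraicClasses (fiberOver f t) q,
      (∀ a ∈ algebraicClasses 𝒳 p,
        cupProduct (show 2 * p + 2 * (q + 1) = 2 * (d + 1) by omega) a (fiberGysin hf t q b) = 0) →
        fiberGysin hf t q b = 0

/-- **`HC_CM ⊢ (L) ⟺ Num^CM`** (§3 with the node's name). `HC_CM` is a BINDER. [cite: Kleiman1968AlgebraicCycles, §3]
[cite: Andre1996Motifs, §6.3 (p. 33)] -/
theorem cmFibreAlgebraicLift_iff_cmPointedPencilNumerical_of_HC_CM (hCM : RankFourFaces.CMAbelianHodge) :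
    CMFibreAlgebraicLift ↔ CMPointedPencilNumerical :=
  cmFibreAlgebraicLift_iff_numerical_of_HC_CM hCM

/-- **THE CELL ROW: `h₂₁ → HC_CM → Num^CM → HC_AV`.** `HC_CM`, `h₂₁` BINDERS. research route, not a corollary; conditional on
HC_CM plus one named minimal statement. [cite: Andre1996Motifs, Lemme 6.3.1 (p. 31) and §6.3 (p. 33)] -/
theorem HC_AV_of_HC_CM_of_cmPointedPencilNumerical (h₂₁ : andre1996_cmAnchoredPencil)
    (hCM : RankFourFaces.CMAbelianHodge) (hNum : CMPointedPencilNumerical) :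
    PadicSemiregularLift.HodgeAbelianVarieties :=
  HC_AV_of_HC_CM_of_numerical h₂₁ hCM hNum

/-- **ON-PATH: `HodgeConjecture ⟹ Num^CM`.** [cite: Andre1996Motifs, §6.3 (p. 33)] -/
theorem cmPointedPencilNumerical_of_hodgeConjecture (h : _root_.HodgeConjecture) : CMPointedPencilNumerical :=
  numericalCM_of_hodgeConjecture h

/-- The item reading: granted `h₂₁`, `Num^CM ⟹ CMToAbelian` (stmt-HodgeConjecture-16267); nothing closes the item.
[cite: Andre1996Motifs, Remarque 2 (p. 33)] -/
theorem cmToAbelian_of_andre1996_of_cmPointedPencilNumerical (h₂₁ : andre1996_cmAnchoredPencil)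
    (hNum : CMPointedPencilNumerical) : RankFourFaces.CMToAbelian :=
  fun hCM A _ ↦ HC_AV_of_HC_CM_of_cmPointedPencilNumerical h₂₁ hCM hNum A

end Summit.HodgeConjecture.HodgeConjecture.Ring2.AbelianAll

end
-- buildfix (ops-buildfix lane, 2026-08-20): comment-only re-land to enqueue the hub build after the Milne1999/CM chain repair (LEDGER C-7); no declaration changed.
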